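import Summits.BirchSwinnertonDyer.BirchSwinnertonDyer.Theorems.CyclotomicUntwistPadicDigitLimit
import Summits.BirchSwinnertonDyer.BirchSwinnertonDyer.Theorems.CyclotomicUntwistSecondKindLogForm
import Summits.BirchSwinnertonDyer.BirchSwinnertonDyer.Theorems.CyclotomicUntwistKatzRankOfPadicRank
import HarnessLib

/-!
# Stub `S2k` (`stub_KATZ_rankLeTwo_supersingular`) of the K-SEP skeletons REDUCED TO THE DIGIT THEOREM ALONE:
# Honda's step (cycu-p3, `SecondKindLog`) + the bridge (cycu-p4, `PadicDigitLimit`) + base change (cycu-p4,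
# `KatzRankBaseChange`) leave exactly cycu-p2 g7's finite-level digit expansion `★` of `End_{𝔽₃⟦X⟧}(F̄)` to plug in

Cell `pub/bsd-wall` (D-0145 line `route-BirchSwinnertonDyer-CyclotomicUntwist`), width seat `bsd-line-cycu-p4` (gen 8). THEOREMS
ONLY (no definition, no named fact, no `sorry`); helper `--supports` K1 = stmt-BirchSwinnertonDyer-21580 (serves K2 = 21581).
BSD is not proved by this file and no crux / stub is; `S2k` itself lands once `★` does.

* `honda_step` — the lead's binder `hW1` for every `V₀/ℤ₃` with elliptic fibres, from cycu-p3's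
  `SecondKindLog.exists_isPadicInt_formalLog_subst_eq` (the log-type bound is not even used);
* **`padicRankTwo_supersingular_of_digits`** — `H3ss` (the supersingular `ℤ₃` rank-`2` statement, binder of
  `KatzRankBaseChange.stub_KATZ_rankLeTwo_supersingular_of_padicRankTwo`) from the digit theorem `hDigAll` alone;
* **`stub_KATZ_rankLeTwo_supersingular_of_digits`** — the registered stub `S2k` VERBATIM from `hDigAll` alone.

References: N. M. Katz, LNM 868 (1981) Thm 5.3.3 [Katz1981CrystallineDieudonne]; T. Honda, J. Math. Soc. Japan 22 (1970)
Thm. 2 [Honda1970].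
-/

set_option autoImplicit false
-- single-conjunct summit: `Summit.BirchSwinnertonDyer.BirchSwinnertonDyer.…` repeats the name by design
set_option linter.dupNamespace false

noncomputable section

open scoped Classical
open PowerSeries WeierstrassCurve Literature.NumberTheory.EllipticCurves
  Literature.NumberTheory.EllipticCurves.DescendedFrobenius
  Summit.BirchSwinnertonDyer.BirchSwinnertonDyer.Theorems

namespace Summit.BirchSwinnertonDyer.BirchSwinnertonDyer.Theorems.KatzRankSupersingular

/-- **Honda's step for every `V₀/ℤ₃` with elliptic fibres** (cycu-p3 g8's `exists_isPadicInt_formalLog_subst_eq`, in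
the lead's binder shape `hW1`). [cite: Honda1970, Thm. 2] -/
theorem honda_step (V₀ : WeierstrassCurve ℤ_[3]) [(V₀.map PadicInt.Coe.ringHom).IsElliptic]
    [(V₀.map PadicInt.toZMod).IsElliptic] (g : ℚ_[3]⟦X⟧) (hg0 : constantCoeff g = 0)
    (_hd : ∃ d : ℕ, ∀ n : ℕ, ‖(3 : ℚ_[3]) ^ d * ((n : ℚ_[3]) * coeff n g)‖ ≤ 1)
    (hd' : ∃ d' : ℕ, ∀ e : Fin 2 →₀ ℕ, ‖(3 : ℚ_[3]) ^ d' * MvPowerSeries.coeff e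
      (g.subst (V₀.map PadicInt.Coe.ringHom).formalGroupLaw - g.subst (MvPowerSeries.X 0) -
        g.subst (MvPowerSeries.X 1))‖ ≤ 1) :
    ∃ (k : ℕ) (h : ℚ_[3]⟦X⟧), constantCoeff h = 0 ∧ IsPadicInt h ∧
      (V₀.map PadicInt.Coe.ringHom).formalLog.subst h = C ((3 : ℚ_[3]) ^ k) * g := by
  obtain ⟨d', hSK⟩ := hd'
  obtain ⟨k, ψ, hψint, hψ0, hψ⟩ := SecondKindLog.exists_isPadicInt_formalLog_subst_eq V₀ hg0 hSK (by norm_num)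
  exact ⟨k, ψ, hψ0, hψint, by rw [hψ]; norm_cast⟩

/-- **`H3ss` FROM THE DIGIT THEOREM ALONE.** If for every `V₀/ℤ₃` with elliptic fibres and supersingular reduction every
integral `H ∈ Xℤ₃⟦X⟧` whose reduction is an endomorphism of the reduced formal group admits the finite-level digit
expansions `H̄ = F̄(F̄([a_J]X, [b_J](X³)), [3ᴶ](g_J))` with `a_J → A`, `b_J → B` in `ℤ₃` (cycu-p2 g7's `★`), then every
second-kind `ℚ₃`-series of such a `V₀` is `≡ a·log + b·log(X³)` modulo `3`-power-bounded denominators.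
[cite: Katz1981CrystallineDieudonne, Thm. 5.3.3] -/
theorem padicRankTwo_supersingular_of_digits
    (hDigAll : ∀ (V₀ : WeierstrassCurve ℤ_[3]) [(V₀.map PadicInt.Coe.ringHom).IsElliptic]
      [(V₀.map PadicInt.toZMod).IsElliptic], (3 : ℤ) ∣ HasseManin.tr (V₀.map PadicInt.toZMod) →
      ∀ H : ℤ_[3]⟦X⟧, constantCoeff H = 0 →
      (H.map PadicInt.toZMod).subst (V₀.map PadicInt.toZMod).formalGroupLaw =
        MvPowerSeries.subst ![(H.map PadicInt.toZMod).subst (MvPowerSeries.X 0 : MvPowerSeries (Fin 2) (ZMod 3)),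
          (H.map PadicInt.toZMod).subst (MvPowerSeries.X 1 : MvPowerSeries (Fin 2) (ZMod 3))]
          (V₀.map PadicInt.toZMod).formalGroupLaw →
      ∃ (A B : ℤ_[3]) (a b : ℕ → ℕ) (g : ℕ → (ZMod 3)⟦X⟧),
        (∀ J, constantCoeff (g J) = 0) ∧
        (∀ J, ‖((a J : ℤ_[3]) - A : ℤ_[3])‖ ≤ (3 : ℝ) ^ (-(J : ℤ)) ∧ ‖((b J : ℤ_[3]) - B : ℤ_[3])‖ ≤ (3 : ℝ) ^ (-(J : ℤ))) ∧
        ∀ J, H.map PadicInt.toZMod =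
          MvPowerSeries.subst ![MvPowerSeries.subst ![(V₀.map PadicInt.toZMod).formalMul (a J),
              expand 3 (by norm_num) ((V₀.map PadicInt.toZMod).formalMul (b J))] (V₀.map PadicInt.toZMod).formalGroupLaw,
            ((V₀.map PadicInt.toZMod).formalMul (3 ^ J)).subst (g J)] (V₀.map PadicInt.toZMod).formalGroupLaw) :
    ∀ (V₀ : WeierstrassCurve ℤ_[3]) [(V₀.map PadicInt.Coe.ringHom).IsElliptic]
      [(V₀.map PadicInt.toZMod).IsElliptic], (3 : ℤ) ∣ HasseManin.tr (V₀.map PadicInt.toZMod) →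
      ∀ (g : ℚ_[3]⟦X⟧), constantCoeff g = 0 →
      (∃ d : ℕ, ∀ n : ℕ, ‖(3 : ℚ_[3]) ^ d * ((n : ℚ_[3]) * coeff n g)‖ ≤ 1) →
      (∃ d' : ℕ, ∀ e : Fin 2 →₀ ℕ, ‖(3 : ℚ_[3]) ^ d' * MvPowerSeries.coeff e
        (g.subst (V₀.map PadicInt.Coe.ringHom).formalGroupLaw - g.subst (MvPowerSeries.X 0) -
          g.subst (MvPowerSeries.X 1))‖ ≤ 1) →
      ∃ (a b : ℚ_[3]) (d'' : ℕ), ∀ n : ℕ, ‖(3 : ℚ_[3]) ^ d'' * coeff n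
        (g - PowerSeries.C a * (V₀.map PadicInt.Coe.ringHom).formalLog -
          PowerSeries.C b * expand 3 (by norm_num) (V₀.map PadicInt.Coe.ringHom).formalLog)‖ ≤ 1 := by
  intro V₀ _ _ hss g hg0 hd hd'
  exact PadicDigitLimit.padicRankTwo_of_honda_of_digits V₀ (by norm_num) (honda_step V₀) (hDigAll V₀ hss) g hg0 hd hd'

/-- **Stub `S2k` (`stub_KATZ_rankLeTwo_supersingular`, Lines/dfrob_wan v3 / dfrob_kato v3) FROM THE DIGIT THEOREM ALONE.**
[cite: Katz1981CrystallineDieudonne, Thm. 5.3.3] -/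
theorem stub_KATZ_rankLeTwo_supersingular_of_digits
    (hDigAll : ∀ (V₀ : WeierstrassCurve ℤ_[3]) [(V₀.map PadicInt.Coe.ringHom).IsElliptic]
      [(V₀.map PadicInt.toZMod).IsElliptic], (3 : ℤ) ∣ HasseManin.tr (V₀.map PadicInt.toZMod) →
      ∀ H : ℤ_[3]⟦X⟧, constantCoeff H = 0 →
      (H.map PadicInt.toZMod).subst (V₀.map PadicInt.toZMod).formalGroupLaw =
        MvPowerSeries.subst ![(H.map PadicInt.toZMod).subst (MvPowerSeries.X 0 : MvPowerSeries (Fin 2) (ZMod 3)),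
          (H.map PadicInt.toZMod).subst (MvPowerSeries.X 1 : MvPowerSeries (Fin 2) (ZMod 3))]
          (V₀.map PadicInt.toZMod).formalGroupLaw →
      ∃ (A B : ℤ_[3]) (a b : ℕ → ℕ) (g : ℕ → (ZMod 3)⟦X⟧),
        (∀ J, constantCoeff (g J) = 0) ∧
        (∀ J, ‖((a J : ℤ_[3]) - A : ℤ_[3])‖ ≤ (3 : ℝ) ^ (-(J : ℤ)) ∧ ‖((b J : ℤ_[3]) - B : ℤ_[3])‖ ≤ (3 : ℝ) ^ (-(J : ℤ))) ∧
        ∀ J, H.map PadicInt.toZMod =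
          MvPowerSeries.subst ![MvPowerSeries.subst ![(V₀.map PadicInt.toZMod).formalMul (a J),
              expand 3 (by norm_num) ((V₀.map PadicInt.toZMod).formalMul (b J))] (V₀.map PadicInt.toZMod).formalGroupLaw,
            ((V₀.map PadicInt.toZMod).formalMul (3 ^ J)).subst (g J)] (V₀.map PadicInt.toZMod).formalGroupLaw) :
    ∀ (E : WeierstrassCurve ONine) (ρ : ONine →+* ZMod 3), IsUnit (E.map ρ).Δ → (3 : ℤ) ∣ HasseManin.tr (E.map ρ) →
      ∀ f : Fin 3 → KNine⟦X⟧,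
        (∀ i, constantCoeff (f i) = 0 ∧
          (∃ d : ℕ, ∀ n : ℕ, _root_.IsIntegral ℤ_[3] ((3 : KNine) ^ d * ((n : KNine) * coeff n (f i)))) ∧
          (∃ d' : ℕ, ∀ e : Fin 2 →₀ ℕ, _root_.IsIntegral ℤ_[3] ((3 : KNine) ^ d' * MvPowerSeries.coeff e
            ((f i).subst (E.map (algebraMap ONine KNine)).formalGroupLaw - (f i).subst (MvPowerSeries.X 0) -
              (f i).subst (MvPowerSeries.X 1))))) →
        ∃ a : Fin 3 → KNine, a ≠ 0 ∧ HasBoundedDenominators (∑ i, PowerSeries.C (a i) * f i) :=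
  KatzRankBaseChange.stub_KATZ_rankLeTwo_supersingular_of_padicRankTwo (padicRankTwo_supersingular_of_digits hDigAll)

end Summit.BirchSwinnertonDyer.BirchSwinnertonDyer.Theorems.KatzRankSupersingular

end
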